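import Mathlib
import Literature.Computability.AlgebraicComplexity.MatrixMultiplicationExponent
import Literature.RingTheory.MvPolynomial.MultigradedHilbertFunction
import Literature.RingTheory.MvPolynomial.MultigradedHilbertPolynomial
import Literature.Computability.AlgebraicComplexity.BorderApolarityCandidates
import Summits.MatrixMultiplication.MatrixMultiplication.Theorems.FidelityWitnessesFidelityGapThreeSeventeenDefs

/-!
# `FidelityWitnesses.FidelityGapThreeSeventeen` (stmt-MatrixMultiplication-4958), line
# `symbolic-square-border-apolarity`, stub S0: a general configuration of `17` points

`stub_generalConfiguration : ∃ x : Fin 17 → Var → ℂ, GeneralConfiguration 17 x`.  The points are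
`u_ρ ⊗ u_ρ ⊗ u_ρ`, `u_ρ = e_a + e_b ∈ ℂ⁹` the indicator of an edge `{a, b}` of a fixed TRIANGLE-FREE graph with `17`
edges on the nine slot indices.  For each multidegree `m` we list `N` functionals `φ_i` (value, or value of one
first partial, at a point) and `N` monomials `f_i ∈ S_m` with `φ_i (f_j) = 0` for `i < j` and `φ_i (f_i) ≠ 0`, so the
`φ_i` have rank `N` on `S_m` and their common kernel has codimension `≥ N` (rank–nullity,
`GenCfg.finrank_inf_iInf_ker_add_le`).  The rows come from a rule (for an edge `{a, b}` and `v ∉ {a, b}` one of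
`{v, a}`, `{v, b}` is a non-edge, so every out-of-support partial owns a PRIVATE monomial; the in-support partials
of a point form a fixed triangular block) and triangularity is re-checked by the kernel (`decide +kernel`, no
`native_decide`), as for the tree's `MatMulTwo.rank_test_ge`.  Elementary linear algebra [folklore]; general
double points as in Buczyńska–Buczyński (Duke 2021, Thm 1.2) and Conner–Harper–Landsberg (Forum Math. Pi 2023,
§2–§3).  NOT here: anything about the tensor.
-/

noncomputable section

namespace Summit.MatrixMultiplication.MatrixMultiplication.Theorems.SymbolicSquare

-- single-conjunct summit: the `Summit.<S>.<P>` prefix repeats `MatrixMultiplication` by design (D-0017)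
set_option linter.dupNamespace false

open Literature.Computability.AlgebraicComplexity

namespace GenCfg

open MvPolynomial

/-- The `17` edges `{a, b}`, `a ∈ {0,1,2,3}`, `b ∈ {4,…,8}` (bipartite, hence triangle-free). [folklore] -/
def edgeList : List (ℕ × ℕ) :=
  [(0, 5), (0, 6), (0, 7), (0, 8), (1, 4), (1, 6), (1, 7), (1, 8), (2, 4), (2, 5), (2, 7), (2, 8), (3, 4),
    (3, 5), (3, 6), (3, 7), (3, 8)]

/-- Edge number `r` (junk `(0, 0)` out of range). [folklore] -/
def edge (r : ℕ) : ℕ × ℕ := edgeList.getD r (0, 0)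

/-- Adjacency in the graph. [folklore] -/
def isEdge (a b : ℕ) : Bool := edgeList.any fun e => (e.1 == a && e.2 == b) || (e.1 == b && e.2 == a)

/-- The variable code `c = 9·slot + 3i + j < 27` lies in the support of the point with edge `e` (the same pair
of slot indices `c % 9 ∈ e` in each of the three slots). [folklore] -/
def inSupp (e : ℕ × ℕ) (c : ℕ) : Bool := Nat.beq (c % 9) e.1 || Nat.beq (c % 9) e.2

/-- The `0/1` value of the point with edge `e` at the variable code `c`. [folklore] -/
def pv (e : ℕ × ℕ) (c : ℕ) : ℕ := if inSupp e c then 1 else 0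

/-- Decoding a variable code `9·slot + 3i + j`. [folklore] -/
def dec (c : ℕ) : Var :=
  (⟨c / 9 % 3, Nat.mod_lt _ (by decide)⟩, (⟨c / 3 % 3, Nat.mod_lt _ (by decide)⟩, ⟨c % 3, Nat.mod_lt _ (by decide)⟩))

/-- Encoding a variable. [folklore] -/
def enc (v : Var) : ℕ := 9 * v.1.val + 3 * v.2.1.val + v.2.2.val

/-- **The configuration**: the point `ρ` is the indicator of the edge `edge ρ` in each slot. [folklore] -/
def cfg (ρ : Fin 17) (v : Var) : ℂ := (pv (edge ρ.val) (enc v) : ℂ)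

/-- A row: point number `r < 17`, a code `d` (`d < 27`: the functional `f ↦ (∂_{dec d} f)(x_r)`; `d = 27`:
`f ↦ f(x_r)`), and a monomial (a list of variable codes). [folklore] -/
abbrev Row : Type := ℕ × ℕ × List ℕ

/-- The monomial of a list of codes. [folklore] -/
def lprod (L : List ℕ) : Poly := (L.map fun c => (X (dec c) : Poly)).prod

/-- Point number as an element of `Fin 17`. [folklore] -/
def fin17 (r : ℕ) : Fin 17 := ⟨r % 17, Nat.mod_lt _ (by decide)⟩

/-- The functional of a row. [folklore] -/
def func (r d : ℕ) : Poly →ₗ[ℂ] ℂ :=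
  if d < 27 then evalAt (cfg (fin17 r)) ∘ₗ pd (dec d) else evalAt (cfg (fin17 r))

/-- Value of a monomial at the point with edge `e` (short-circuit product of `0/1` values). [folklore] -/
def EN (e : ℕ × ℕ) : List ℕ → ℕ
  | [] => 1
  | c :: L => bif inSupp e c then EN e L else 0

/-- Value of `∂_d` of a monomial at the point with edge `e` (Leibniz rule along the list). [folklore] -/
def DN (e : ℕ × ℕ) (d : ℕ) : List ℕ → ℕ
  | [] => 0
  | c :: L => (bif Nat.beq c d then EN e L else 0) + (bif inSupp e c then DN e d L else 0)

/-- Value of the functional `(e, d)` on a monomial. [folklore] -/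
def valN (e : ℕ × ℕ) (d : ℕ) (L : List ℕ) : ℕ := bif Nat.blt d 27 then DN e d L else EN e L

/-- Number of variables of slot `k` in a monomial. [folklore] -/
def slotCount (L : List ℕ) (k : ℕ) : ℕ := L.countP fun c => c / 9 % 3 == k

/-- A row is well-formed for the multidegree `m` (`ev = true`: evaluations only) and its functional does not
vanish on its monomial. [folklore] -/
def rowOK (m : MDeg) (ev : Bool) (row : Row) : Bool :=
  decide (row.1 < 17) && (!ev || row.2.1 == 27) && row.2.2.all (fun c => decide (c < 27)) &&
    (slotCount row.2.2 0 == m 0) && (slotCount row.2.2 1 == m 1) && (slotCount row.2.2 2 == m 2) &&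
    !(valN (edge row.1) row.2.1 row.2.2 == 0)

/-- Lower triangularity: the functional of each row vanishes on the monomials of all LATER rows. [folklore] -/
def triOK : List Row → Bool
  | [] => true
  | row :: rest => rest.all (fun row' => Nat.beq (valN (edge row.1) row.2.1 row'.2.2) 0) && triOK rest

/-- A valid case: `n` well-formed rows, lower triangular. [folklore] -/
def caseOK (m : MDeg) (ev : Bool) (n : ℕ) (rows : List Row) : Bool :=
  (rows.length == n) && rows.all (rowOK m ev) && triOK rows

/-- Variable code of slot `k`, index `p`. [folklore] -/
def cd (k p : ℕ) : ℕ := 9 * k + p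

/-- Simple-point rows for `m`: the point `{a, b}` gets the monomial with `a` once (in the first active slot)
and `b` elsewhere — no other point sees it. [folklore] -/
def simpleRows (m : MDeg) : List Row :=
  (List.range 17).map fun r =>
    let b := (edge r).2
    let k : ℕ := if 0 < m 0 then 0 else if 0 < m 1 then 1 else 2
    (r, 27, cd k (edge r).1 :: List.replicate (m 0 - if k = 0 then 1 else 0) (cd 0 b) ++
      List.replicate (m 1 - if k = 1 then 1 else 0) (cd 1 b) ++ List.replicate (m 2 - if k = 2 then 1 else 0) (cd 2 b))

/-- For `v ∉ {a, b}`: `(u, w)` with `{u, w} = {a, b}` and `{v, u}` a NON-edge (triangle-freeness). [folklore] -/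
def uw (v a b : ℕ) : ℕ × ℕ := if isEdge v a then (b, a) else (a, b)

/-- Double-point rows: for every point `{a, b}` the in-support block `blk a b`, then for every point and every
`v ∉ {a, b}` the out-of-support rows `out v u w` (`(u, w) = uw v a b`). [folklore] -/
def mkRows (blk : ℕ → ℕ → List (ℕ × List ℕ)) (out : ℕ → ℕ → ℕ → List (ℕ × List ℕ)) : List Row :=
  ((List.range 17).flatMap fun r => (blk (edge r).1 (edge r).2).map fun dl => (r, dl)) ++
    (List.range 17).flatMap fun r =>
      (((List.range 9).filter fun v => !(v == (edge r).1) && !(v == (edge r).2)).flatMap fun v =>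
        out v (uw v (edge r).1 (edge r).2).1 (uw v (edge r).1 (edge r).2).2).map fun dl => (r, dl)

/-- Type `(2,2,0)` in the slots `s, t`: `∂x_b ↦ x_a x_b y_a y_b`, `∂y_a ↦ x_a² y_a y_b`, `∂x_a ↦ x_a² y_b²`, then
the private monomials `∂x_v ↦ x_v x_w y_u²`, `∂y_v ↦ x_u² y_v y_w`. [folklore] -/
def rows220 (s t : ℕ) : List Row :=
  mkRows (fun a b => [(cd s b, [cd s a, cd s b, cd t a, cd t b]), (cd t a, [cd s a, cd s a, cd t a, cd t b]),
      (cd s a, [cd s a, cd s a, cd t b, cd t b])])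
    fun v u w => [(cd s v, [cd s v, cd s w, cd t u, cd t u]), (cd t v, [cd s u, cd s u, cd t v, cd t w])]

/-- Type `(3,1,0)` (degree `3` in slot `s`): `∂y_a ↦ x_a x_b² y_a`, `∂x_b ↦ x_a² x_b y_b`, `∂x_a ↦ x_a³ y_b`,
then `∂x_v ↦ x_v x_u² y_w`, `∂y_v ↦ x_u² x_w y_v`. [folklore] -/
def rows310 (s t : ℕ) : List Row :=
  mkRows (fun a b => [(cd t a, [cd s a, cd s b, cd s b, cd t a]), (cd s b, [cd s a, cd s a, cd s b, cd t b]),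
      (cd s a, [cd s a, cd s a, cd s a, cd t b])])
    fun v u w => [(cd s v, [cd s v, cd s u, cd s u, cd t w]), (cd t v, [cd s u, cd s u, cd s w, cd t v])]

/-- Type `(2,1,1)` (degree `2` in slot `s`): `∂y_a ↦ x_a x_b y_a z_a`, `∂z_a ↦ x_a² y_b z_a`,
`∂x_b ↦ x_a x_b y_b z_b`, `∂x_a ↦ x_a² y_b z_b`, then `∂x_v ↦ x_v x_u y_u z_w`, `∂y_v ↦ x_u² y_v z_w`,
`∂z_v ↦ x_u² y_w z_v`. [folklore] -/
def rows211 (s t t' : ℕ) : List Row :=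
  mkRows (fun a b => [(cd t a, [cd s a, cd s b, cd t a, cd t' a]), (cd t' a, [cd s a, cd s a, cd t b, cd t' a]),
      (cd s b, [cd s a, cd s b, cd t b, cd t' b]), (cd s a, [cd s a, cd s a, cd t b, cd t' b])])
    fun v u w => [(cd s v, [cd s v, cd s u, cd t u, cd t' w]), (cd t v, [cd s u, cd s u, cd t v, cd t' w]),
      (cd t' v, [cd s u, cd s u, cd t w, cd t' v])]

/-- The double-point rows of the twelve degree-`4` multidegrees (dispatch on `m 0, m 1, m 2`). [folklore] -/
def doubleRows (m : MDeg) : List Row :=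
  if m 0 = 3 ∧ m 1 = 1 then rows310 0 1 else if m 0 = 1 ∧ m 1 = 3 then rows310 1 0
  else if m 0 = 3 ∧ m 2 = 1 then rows310 0 2 else if m 0 = 1 ∧ m 2 = 3 then rows310 2 0
  else if m 1 = 3 ∧ m 2 = 1 then rows310 1 2 else if m 1 = 1 ∧ m 2 = 3 then rows310 2 1
  else if m 0 = 2 ∧ m 1 = 2 then rows220 0 1 else if m 0 = 2 ∧ m 2 = 2 then rows220 0 2
  else if m 1 = 2 ∧ m 2 = 2 then rows220 1 2
  else if m 0 = 2 then rows211 0 1 2 else if m 1 = 2 then rows211 1 0 2 else rows211 2 0 1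

/-- **Kernel run**, the `25` simple-point cases. [folklore] -/
theorem check1 : ∀ m ∈ degsData ++ degs4, caseOK m true 17 (simpleRows m) = true :=
  List.all_eq_true.1 (by decide +kernel)

-- one auxiliary kernel lemma per case (an `O(N²)` triangularity check, `N = 289, 425`; no `native_decide`);
-- the heartbeats of the cases of one `theorem` add up
set_option maxHeartbeats 1000000 in
/-- **Kernel runs**, the nine `17 r` double-point cases. [folklore] -/
theorem check17 : ∀ m ∈ [m310, m130, m301, m103, m031, m013, m220, m202, m022],
    caseOK m false 289 (doubleRows m) = true := by
  intro m hm
  simp only [List.mem_cons, List.mem_nil_iff, or_false] at hm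
  rcases hm with rfl | rfl | rfl | rfl | rfl | rfl | rfl | rfl | rfl <;> decide +kernel

set_option maxHeartbeats 1000000 in
/-- **Kernel runs**, the three `25 r` double-point cases. [folklore] -/
theorem check25 : ∀ m ∈ [m211, m121, m112], caseOK m false 425 (doubleRows m) = true := by
  intro m hm
  simp only [List.mem_cons, List.mem_nil_iff, or_false] at hm
  rcases hm with rfl | rfl | rfl <;> decide +kernel


/-- `enc ∘ dec = id` on codes `< 27`. [folklore] -/
theorem enc_dec {c : ℕ} (hc : c < 27) : enc (dec c) = c := by
  simp only [enc, dec]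
  omega

/-- The value of a monomial at a `0/1` point is computed by `EN`. [folklore] -/
theorem aeval_lprod (e : ℕ × ℕ) (L : List ℕ) (hL : ∀ c ∈ L, c < 27) :
    aeval (fun v => (pv e (enc v) : ℂ)) (lprod L) = (EN e L : ℂ) := by
  induction L with
  | nil => simp [lprod, EN]
  | cons c L ih =>
    have ih' := ih fun c' hc' => hL c' (List.mem_cons_of_mem _ hc')
    unfold lprod at ih' ⊢
    rw [List.map_cons, List.prod_cons, map_mul, ih', aeval_X, enc_dec (hL c List.mem_cons_self)]
    simp only [EN, pv]
    cases inSupp e c <;> simp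

/-- The value of a first partial of a monomial at a `0/1` point is computed by `DN`. [folklore] -/
theorem aeval_pderiv_lprod (e : ℕ × ℕ) {d : ℕ} (hd : d < 27) (L : List ℕ) (hL : ∀ c ∈ L, c < 27) :
    aeval (fun v => (pv e (enc v) : ℂ)) (pderiv (dec d) (lprod L)) = (DN e d L : ℂ) := by
  induction L with
  | nil => simp [lprod, DN]
  | cons c L ih =>
    have hc : c < 27 := hL c List.mem_cons_self
    have hL' : ∀ c' ∈ L, c' < 27 := fun c' hc' => hL c' (List.mem_cons_of_mem _ hc')
    have hE := aeval_lprod e L hL'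
    have ih' := ih hL'
    unfold lprod at hE ih' ⊢
    rw [List.map_cons, List.prod_cons, pderiv_mul, map_add, map_mul, map_mul, ih', hE, aeval_X,
      enc_dec hc]
    cases hb : Nat.beq c d with
    | true =>
      have hcd : c = d := Nat.eq_of_beq_eq_true hb
      subst hcd
      rw [pderiv_X_self, map_one]
      simp only [DN, hb, pv, cond_true]
      cases inSupp e c <;> push_cast <;> simp
    | false =>
      have hcd : dec c ≠ dec d := fun h =>
        Nat.ne_of_beq_eq_false hb (by rw [← enc_dec hc, ← enc_dec hd, h])
      rw [pderiv_X_of_ne hcd, map_zero]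
      simp only [DN, hb, pv, cond_false]
      cases inSupp e c <;> push_cast <;> simp

/-- The functional of a row on a well-formed monomial is computed by `valN`. [folklore] -/
theorem func_lprod {r : ℕ} (d : ℕ) (hr : r < 17) {L : List ℕ} (hL : ∀ c ∈ L, c < 27) :
    func r d (lprod L) = (valN (edge r) d L : ℂ) := by
  have hcfg : cfg (fin17 r) = fun v => (pv (edge r) (enc v) : ℂ) := by
    funext v
    simp [cfg, fin17, Nat.mod_eq_of_lt hr]
  unfold func valN
  by_cases h27 : d < 27
  · rw [if_pos h27, show Nat.blt d 27 = true from Nat.blt_eq.mpr h27, LinearMap.comp_apply, hcfg, cond_true]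
    exact aeval_pderiv_lprod _ h27 L hL
  · have hb : Nat.blt d 27 = false := by
      cases h : Nat.blt d 27 with
      | false => rfl
      | true => simp only [Nat.blt_eq] at h; exact absurd h h27
    rw [if_neg h27, hb, hcfg, cond_false]
    exact aeval_lprod _ L hL

/-- The monomial of a list of codes lies in the piece of its slot counts. [folklore] -/
theorem lprod_mem (L : List ℕ) : lprod L ∈ S (fun k : Fin 3 => slotCount L k.val) := by
  induction L with
  | nil =>
    rw [show (fun k : Fin 3 => slotCount [] k.val) = 0 from funext fun k => by simp [slotCount]]
    exact isWeightedHomogeneous_one ℂ wt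
  | cons c L ih =>
    have hdeg : (fun k : Fin 3 => slotCount (c :: L) k.val) = wt (dec c) + fun k : Fin 3 => slotCount L k.val := by
      funext k
      simp only [slotCount, List.countP_cons, wt, Pi.add_apply]
      rw [Pi.single_apply]
      have hk : (k = (dec c).1) ↔ c / 9 % 3 = k.val := by
        simp only [dec, Fin.ext_iff]
        omega
      by_cases h : c / 9 % 3 = k.val
      · rw [if_pos (hk.mpr h)]
        simp [h, add_comm]
      · rw [if_neg (fun h' => h (hk.mp h'))]
        simp [h]
    rw [hdeg]
    exact IsWeightedHomogeneous.mul (isWeightedHomogeneous_X ℂ wt (dec c)) ih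

/-- What a well-formed row guarantees. [folklore] -/
theorem rowOK_spec {m : MDeg} {ev : Bool} {row : Row} (h : rowOK m ev row = true) :
    row.1 < 17 ∧ (ev = true → row.2.1 = 27) ∧ (∀ c ∈ row.2.2, c < 27) ∧
      (fun k : Fin 3 => slotCount row.2.2 k.val) = m ∧ valN (edge row.1) row.2.1 row.2.2 ≠ 0 := by
  simp only [rowOK, Bool.and_eq_true, decide_eq_true_eq, List.all_eq_true, Bool.or_eq_true,
    beq_iff_eq, Bool.not_eq_true'] at h
  obtain ⟨⟨⟨⟨⟨⟨h1, h3⟩, h4⟩, h5⟩, h6⟩, h7⟩, h8⟩ := h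
  refine ⟨h1, fun hev => ?_, h4, ?_, fun h0 => ?_⟩
  · subst hev
    simpa using h3
  · funext k
    fin_cases k
    · exact h5
    · exact h6
    · exact h7
  · rw [h0] at h8
    simp at h8

/-- What lower triangularity guarantees. [folklore] -/
theorem triOK_spec {rows : List Row} (h : triOK rows = true) :
    rows.Pairwise fun row row' => valN (edge row.1) row.2.1 row'.2.2 = 0 := by
  induction rows with
  | nil => exact List.Pairwise.nil
  | cons row rest ih =>
    simp only [triOK, Bool.and_eq_true, List.all_eq_true] at h
    exact List.Pairwise.cons (fun row' hr => Nat.eq_of_beq_eq_true (h.1 row' hr)) (ih h.2)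

/-- **Rank–nullity bound.** If `N` functionals `ψ_i` and `N` vectors `f_j ∈ V` have a lower triangular matrix
`ψ_i (f_j)` with nonzero diagonal, the common kernel of the `ψ_i` has codimension `≥ N` in `V`. [folklore] -/
theorem finrank_inf_iInf_ker_add_le (V : Submodule ℂ Poly) [FiniteDimensional ℂ V] {N : ℕ}
    (ψ : Fin N → Poly →ₗ[ℂ] ℂ) (f : Fin N → Poly) (hf : ∀ j, f j ∈ V) (hdiag : ∀ i, ψ i (f i) ≠ 0)
    (htri : ∀ i j, i < j → ψ i (f j) = 0) :
    Module.finrank ℂ ↥(V ⊓ ⨅ i, LinearMap.ker (ψ i)) + N ≤ Module.finrank ℂ V := by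
  let Ψ : V →ₗ[ℂ] (Fin N → ℂ) := LinearMap.pi fun i => (ψ i).comp V.subtype
  let col : Fin N → Fin N → ℂ := fun j => Ψ ⟨f j, hf j⟩
  have hli : LinearIndependent ℂ col :=
    BorderApolarity.linearIndependent_of_triangular col id (fun t => hdiag t) fun s t hts => htri t s hts
  have h1 : N ≤ Module.finrank ℂ (LinearMap.range Ψ) := by
    have hspan : Submodule.span ℂ (Set.range col) ≤ LinearMap.range Ψ := by
      rw [Submodule.span_le]
      rintro _ ⟨j, rfl⟩
      exact ⟨⟨f j, hf j⟩, rfl⟩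
    calc N = Fintype.card (Fin N) := (Fintype.card_fin N).symm
      _ = Module.finrank ℂ (Submodule.span ℂ (Set.range col)) := (finrank_span_eq_card hli).symm
      _ ≤ _ := Submodule.finrank_mono hspan
  have h2 : Module.finrank ℂ ↥(V ⊓ ⨅ i, LinearMap.ker (ψ i)) ≤ Module.finrank ℂ (LinearMap.ker Ψ) := by
    have hle : V ⊓ ⨅ i, LinearMap.ker (ψ i) ≤ (LinearMap.ker Ψ).map V.subtype := by
      intro p hp
      rw [Submodule.mem_inf, Submodule.mem_iInf] at hp
      refine ⟨⟨p, hp.1⟩, ?_, rfl⟩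
      simp only [SetLike.mem_coe, LinearMap.mem_ker]
      funext i
      exact LinearMap.mem_ker.1 (hp.2 i)
    calc _ ≤ Module.finrank ℂ ((LinearMap.ker Ψ).map V.subtype) := Submodule.finrank_mono hle
      _ = _ := Submodule.finrank_map_subtype_eq V (LinearMap.ker Ψ)
  have hrn := LinearMap.finrank_range_add_finrank_ker Ψ
  omega

/-- **Soundness of a case.** A valid case with `n` rows for `m` gives `dim (S_m ∩ I(2Γ)) + n ≤ dim S_m`, and, if
it uses evaluations only, `dim (S_m ∩ I(Γ)) + n ≤ dim S_m`. [folklore] -/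
theorem bounds_of_caseOK {m : MDeg} {ev : Bool} {n : ℕ} {rows : List Row} (h : caseOK m ev n rows = true) :
    Module.finrank ℂ ↥(dpSub m cfg) + n ≤ Module.finrank ℂ ↥(S m) ∧
      (ev = true → Module.finrank ℂ ↥(spSub m cfg) + n ≤ Module.finrank ℂ ↥(S m)) := by
  simp only [caseOK, Bool.and_eq_true, beq_iff_eq, List.all_eq_true] at h
  obtain ⟨⟨hlen, hall⟩, htri⟩ := h
  subst hlen
  have hrow := fun i : Fin rows.length => rowOK_spec (hall _ (List.getElem_mem i.isLt))
  let ψ : Fin rows.length → Poly →ₗ[ℂ] ℂ := fun i => func (rows[i.1]).1 (rows[i.1]).2.1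
  let f : Fin rows.length → Poly := fun i => lprod (rows[i.1]).2.2
  have hf : ∀ i, f i ∈ S m := fun i => by
    rw [← (hrow i).2.2.2.1]
    exact lprod_mem _
  have hval : ∀ i j, ψ i (f j) = (valN (edge (rows[i.1]).1) (rows[i.1]).2.1 (rows[j.1]).2.2 : ℂ) :=
    fun i j => func_lprod _ (hrow i).1 (hrow j).2.2.1
  have hdiag : ∀ i, ψ i (f i) ≠ 0 := fun i => by
    rw [hval, Nat.cast_ne_zero]
    exact (hrow i).2.2.2.2
  have htri' : ∀ i j, i < j → ψ i (f j) = 0 := fun i j hij => by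
    rw [hval, Nat.cast_eq_zero]
    exact List.pairwise_iff_getElem.1 (triOK_spec htri) i j i.isLt j.isLt hij
  haveI : Module.Finite ℂ (S m) :=
    Literature.RingTheory.MvPolynomial.finite_weightedHomogeneousSubmodule_of_ne_zero wt
      (fun v h => by simpa [wt] using congr_fun h v.1) m
  have key := finrank_inf_iInf_ker_add_le (S m) ψ f hf hdiag htri'
  -- the two target subspaces sit inside `S m ⊓ ⨅ ker ψ_i`
  have hle : ∀ p ∈ S m, (∀ i : Fin rows.length, p ∈ vanishDoublyAt (cfg (fin17 (rows[i.1]).1)) ∨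
      (ev = true ∧ p ∈ vanishAt (cfg (fin17 (rows[i.1]).1)))) → p ∈ S m ⊓ ⨅ i, LinearMap.ker (ψ i) := by
    intro p hpS hp
    refine Submodule.mem_inf.2 ⟨hpS, (Submodule.mem_iInf _).2 fun i => ?_⟩
    change p ∈ LinearMap.ker (func _ _)
    unfold func
    rcases hp i with hρ | ⟨hev, hρ⟩
    · obtain ⟨h0, h1⟩ := Submodule.mem_inf.1 hρ
      split_ifs
      · exact (Submodule.mem_iInf _).1 h1 _
      · exact h0
    · rw [if_neg (by rw [(hrow i).2.1 hev]; decide)]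
      exact hρ
  have hdp : dpSub m cfg ≤ S m ⊓ ⨅ i, LinearMap.ker (ψ i) := fun p hp =>
    hle p (Submodule.mem_inf.1 hp).1 fun i =>
      Or.inl ((Submodule.mem_iInf _).1 (Submodule.mem_inf.1 hp).2 _)
  have hsp : ev = true → spSub m cfg ≤ S m ⊓ ⨅ i, LinearMap.ker (ψ i) := fun hev p hp =>
    hle p (Submodule.mem_inf.1 hp).1 fun i =>
      Or.inr ⟨hev, (Submodule.mem_iInf _).1 (Submodule.mem_inf.1 hp).2 _⟩
  exact ⟨le_trans (Nat.add_le_add_right (Submodule.finrank_mono hdp) _) key,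
    fun hev => le_trans (Nat.add_le_add_right (Submodule.finrank_mono (hsp hev)) _) key⟩

end GenCfg

open GenCfg in
/-- **Stub S0 of the line `symbolic-square-border-apolarity`: a general configuration of `17` points.**
The `17` points `u_ρ ⊗ u_ρ ⊗ u_ρ` (`u_ρ ∈ {0,1}⁹` the indicator of an edge of a triangle-free graph with `17`
edges on the nine slot indices) impose independent conditions: `17` simple ones on each of the `25` pieces
`S_m`, `17 · 17` double-point conditions on the `(3,1,0)`- and `(2,2,0)`-type pieces and `25 · 17` on the
`(2,1,1)`-type pieces (kernel-checked triangular certificates `GenCfg.check1/check17/check25` and rank–nullity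
`GenCfg.bounds_of_caseOK`). [folklore] -/
theorem stub_generalConfiguration : ∃ x : Fin 17 → Var → ℂ, GeneralConfiguration 17 x :=
  ⟨cfg, fun m hm => (bounds_of_caseOK (check1 m hm)).2 rfl,
    fun m hm => by have h := (bounds_of_caseOK (check17 m hm)).1; omega,
    fun m hm => by have h := (bounds_of_caseOK (check25 m hm)).1; omega⟩

end Summit.MatrixMultiplication.MatrixMultiplication.Theorems.SymbolicSquare

end
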